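import Summits.CriticalPhenomena.CardyFormulaZ2.Theses.CardySegmentWeakRSW
import Summits.CriticalPhenomena.CardyFormulaZ2.Theorems.UniformBoxCrossing.Negative.FalseWithoutFKG
import HarnessLib

/-!
# FKG is load-bearing for `WeakBoxCrossing`: at the laminated endpoint the `2 × 1` box is crossed
the easy way with probability `→ 1`
(negative-side support for crux `WeakBoxCrossing`, stmt-CriticalPhenomena-18422, route
`CardySegmentWeakRSW`; refuter crux-attack seat; reuses the lamination machinery of
`UniformBoxCrossing/Negative/{LaminatedPaths, FalseWithoutFKG}` of the parent crux chain)

`WeakBoxCrossing` asks, for every `t ∈ [0,1]`, for a `c > 0` such that along SOME sequence of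
meshes `δ → 0⁺` the crude bottom-to-top (easy-way) crossing probability of the box `(0,2) × (0,1)`
under the corner model `M_t` stays `≤ 1 - c`. The corner family extends verbatim to splitting
parameter `s ∈ [0,1]` (`extCornerParam`, `s = t/2`; `s ≤ 1/2` is exactly the FKG range of the
corner law), keeping translation invariance, the diagonal symmetry, self-duality, the exact-`1/2`
identities and the range-`1` product structure (`UniformBoxCrossing/Negative/ExtendedFamilySymmetries`).

* `extCornerCrossingProb`, `WeakBoxCrossingWithoutFKG` — the crux with `t ≤ 1` dropped
  (`s ∈ [0,1]`); `weakBoxCrossing_iff_restricted` records that the crux is literally the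
  restriction of the extended clause to `s = t/2`.
* `lam_crudeCrossing_of_orbit` — deterministic core: at `s = 1` (laminated forest: every vertex
  opens exactly one of its east/north edges) the forward orbit of the vertex `(1,1)` is an open
  monotone staircase; if it makes at least `M - 1` north steps among its first `3 (M - 2)` steps
  (`M` = the topmost admissible lattice row at mesh `δ`, `√2 δ M < 1 ≤ √2 δ (M+1)`), its initial
  segment up to row `M` is a crude bottom-to-top crossing of `(0,2) × (0,1)` at mesh `δ`
  (it uses `≤ 2M - 5` east steps, and `√2 δ (2M - 4) < 2`).
* `real_orbitEvent_le_three` — the complementary orbit event (at most `m` north steps among the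
  first `3m`) has probability `≤ (8/9)^m` (pattern cylinders + weighted counting of part 2).
* `laminated_crudeCrossing_ge` — hence `P_{s=1}((0,2)×(0,1), δ) ≥ 1 - (8/9)^(M-2)`, and
  `weakBoxCrossing_false_without_FKG : ¬ WeakBoxCrossingWithoutFKG` (witness `s = 1`).

Consequence for provers: even this pointwise, single-box, along-a-subsequence weakening of RSW does
not survive to `s = 1`; a proof of `WeakBoxCrossing` must use positive association (`t ≤ 1`)
quantitatively — none of the soft symmetries of the family suffices. Elementary; [folklore]
(coalescing north-east staircases, "river networks").
-/

namespace Summit.CriticalPhenomena.CardyFormulaZ2.Theorems.WeakBoxCrossing.Negative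

open MeasureTheory Filter Literature.Probability.Percolation Literature.Probability.LatticeModels
open Literature.Probability.RandomPlanarGeometry (ConformalRectangle)
open Summit.CriticalPhenomena.CardyFormulaZ2.Theorems.UniformBoxCrossing.Negative
open Summit.CriticalPhenomena.CardyFormulaZ2.Theses.CardySegmentWeakRSW
open scoped Topology

noncomputable section

/-! ### The extended crude crossing probability and the crux without FKG -/

/-- Crude crossing probability of `R` at mesh `δ` (from within `2δ` of arc `0` to within `2δ` of
arc `2`, inside `R`) for the extended corner model `M_s`, `s ∈ [0,1]`, drawn on `√2 ℤ²`; the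
route's `P t R δ = cornerCrossingProb t R δ` is the case `s = t/2` (`extCornerCrossingProb_half_mul`). -/
def extCornerCrossingProb (s : unitInterval) (R : ConformalRectangle) (δ : ℝ) : ℝ :=
  (prodBernoulli (extCornerParam s)).real
    {S | cornerConfig S ∈ embDomainCrossing squareLatticeEmbedding.z R.carrier δ (R.arc 0) (R.arc 2)}

/-- The route's crude crossing probability is the extended one at `s = t/2`. -/
theorem extCornerCrossingProb_half_mul (t : unitInterval) (R : ConformalRectangle) (δ : ℝ) :
    extCornerCrossingProb (half * t) R δ = cornerCrossingProb t R δ := by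
  rw [extCornerCrossingProb, extCornerParam_half_mul]; rfl

/-- The crux, unfolded: its inlined `let`s are the library objects verbatim. -/
theorem weakBoxCrossing_iff :
    WeakBoxCrossing ↔ ∀ t : unitInterval, ∃ c > 0, ∀ δ₀ : ℝ, 0 < δ₀ → ∃ δ : ℝ, 0 < δ ∧ δ < δ₀ ∧
      cornerCrossingProb t (rectQuad 0 2 0 1 two_pos one_pos) δ ≤ 1 - c :=
  Iff.rfl

/-- `WeakBoxCrossing` with the FKG restriction `t ≤ 1` (i.e. `s ≤ 1/2`) DROPPED: the same
pointwise, one-box, along-a-subsequence non-crossing bound for every `s ∈ [0,1]`. A STRENGTHENING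
of the crux that this file REFUTES (`weakBoxCrossing_false_without_FKG`); posited by the refuter
side, not a literature fact, never to be relocated. -/
def WeakBoxCrossingWithoutFKG : Prop :=
  ∀ s : unitInterval, ∃ c > 0, ∀ δ₀ : ℝ, 0 < δ₀ → ∃ δ : ℝ, 0 < δ ∧ δ < δ₀ ∧
    extCornerCrossingProb s (rectQuad 0 2 0 1 two_pos one_pos) δ ≤ 1 - c

/-- The crux is literally the restriction of the extended clause to `s = t/2`. -/
theorem weakBoxCrossing_iff_restricted :
    WeakBoxCrossing ↔ ∀ t : unitInterval, ∃ c > 0, ∀ δ₀ : ℝ, 0 < δ₀ → ∃ δ : ℝ, 0 < δ ∧ δ < δ₀ ∧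
      extCornerCrossingProb (half * t) (rectQuad 0 2 0 1 two_pos one_pos) δ ≤ 1 - c := by
  simp only [extCornerCrossingProb_half_mul]
  exact weakBoxCrossing_iff

/-! ### Orbit bookkeeping -/

/-- The abscissa is monotone along an orbit. -/
theorem lamOrbit_zero_mono (c : Set (Site 2)) (x : Site 2) {i j : ℕ} (h : i ≤ j) :
    lamOrbit c x i 0 ≤ lamOrbit c x j 0 := by
  obtain ⟨k, rfl⟩ := Nat.exists_eq_add_of_le h
  rw [lamOrbit_add]
  exact le_lamOrbit_zero c _ k

/-- One orbit step raises the ordinate by at most one. -/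
theorem lamOrbit_succ_one_le (c : Set (Site 2)) (x : Site 2) (j : ℕ) :
    lamOrbit c x (j + 1) 1 ≤ lamOrbit c x j 1 + 1 := by
  rw [lamOrbit_succ, lamStep_apply_one]; split_ifs <;> simp

/-- Discrete intermediate value along an orbit: started at ordinate `≤ M` and at ordinate `≥ M`
at time `K`, the orbit sits exactly in row `M` at some time `≤ K`. -/
theorem exists_lamOrbit_one_eq (c : Set (Site 2)) (x : Site 2) {M : ℤ} (h0 : x 1 ≤ M) :
    ∀ K : ℕ, M ≤ lamOrbit c x K 1 → ∃ k ≤ K, lamOrbit c x k 1 = M := by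
  intro K
  induction K with
  | zero =>
    intro hK
    exact ⟨0, le_rfl, le_antisymm (by simpa using h0) hK⟩
  | succ K ih =>
    intro hK
    by_cases h : M ≤ lamOrbit c x K 1
    · obtain ⟨k, hk, hkM⟩ := ih h
      exact ⟨k, hk.trans (Nat.le_succ K), hkM⟩
    · have h1 := lamOrbit_succ_one_le c x K
      have h2 := not_le.1 h
      exact ⟨K + 1, le_rfl, by omega⟩

/-! ### Deterministic core: the orbit of `(1,1)` crosses the box -/

/-- **Deterministic core.** Mesh `δ > 0`, lattice spacing `√2 δ`; let `M ≥ 3` be the row with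
`√2 δ M < 1 ≤ √2 δ (M + 1)` (the topmost lattice row inside the box, within `2δ` of its top side).
If the forward lamination orbit of `(1,1)` makes more than `M - 2` north steps among its first
`3 (M - 2)` steps, then the laminated configuration contains a crude bottom-to-top crossing of
`(0,2) × (0,1)` at mesh `δ` (the orbit segment up to row `M`: at most `2M - 5` east steps, so it
stays in columns `≤ 2M - 4 < 2/(√2 δ)`). -/
theorem lam_crudeCrossing_of_orbit (c : Set (Site 2)) {δ : ℝ} (hδ : 0 < δ) {M : ℕ} (hM : 3 ≤ M)
    (hM1 : Real.sqrt 2 * δ * M < 1) (hM2 : 1 ≤ Real.sqrt 2 * δ * (M + 1))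
    (hgood : ¬ lamOrbit c ![1, 1] (3 * (M - 2)) 1 ≤ (![1, 1] : Site 2) 1 + ((M - 2 : ℕ) : ℤ)) :
    lamConfig c ∈ embDomainCrossing squareLatticeEmbedding.z (rectQuad 0 2 0 1 two_pos one_pos).carrier δ
      ((rectQuad 0 2 0 1 two_pos one_pos).arc 0) ((rectQuad 0 2 0 1 two_pos one_pos).arc 2) := by
  set x : Site 2 := ![1, 1] with hx
  have hx0 : x 0 = 1 := by simp [hx]
  have hx1 : x 1 = 1 := by simp [hx]
  have hs0 : (0 : ℝ) < Real.sqrt 2 := by positivity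
  have hs2 : Real.sqrt 2 < 2 := by linarith [sqrt_two_lt']
  have hh : 0 < Real.sqrt 2 * δ := by positivity
  have hM3 : (3 : ℝ) ≤ M := by exact_mod_cast hM
  have hh1 : Real.sqrt 2 * δ < 1 := by nlinarith
  have h22 : Real.sqrt 2 * δ ≤ 2 * δ := by nlinarith
  -- the orbit reaches row `M` within `3 (M - 2)` steps, hence sits in row `M` at some `k₀`
  have hreach : (M : ℤ) ≤ lamOrbit c x (3 * (M - 2)) 1 := by
    rw [hx1] at hgood; omega
  obtain ⟨k₀, hk₀, hrow⟩ :=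
    exists_lamOrbit_one_eq c x (M := M) (by rw [hx1]; exact_mod_cast (by omega : 1 ≤ M))
      (3 * (M - 2)) hreach
  -- coordinates along the orbit up to time `k₀`
  have hsum := lamOrbit_sum c x k₀
  rw [hx0, hx1, hrow] at hsum
  have hcol0 : lamOrbit c x k₀ 0 ≤ 2 * (M : ℤ) - 4 := by omega
  have hT : ∀ k ≤ k₀, (δ : ℂ) * squareLatticeEmbedding.z (lamOrbit c x k) ∈ (rectQuad 0 2 0 1 two_pos one_pos).carrier := by
    intro k hk
    have hr1 : (1 : ℝ) ≤ lamOrbit c x k 1 := by exact_mod_cast hx1 ▸ le_lamOrbit_one c x k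
    have hr2 : (lamOrbit c x k 1 : ℝ) ≤ M := by exact_mod_cast hrow ▸ lamOrbit_one_mono c x hk
    have hc1 : (1 : ℝ) ≤ lamOrbit c x k 0 := by exact_mod_cast hx0 ▸ le_lamOrbit_zero c x k
    have hc2 : (lamOrbit c x k 0 : ℝ) ≤ 2 * M - 4 := by
      exact_mod_cast (lamOrbit_zero_mono c x hk).trans hcol0
    have e1 : Real.sqrt 2 * δ * (lamOrbit c x k 0 : ℝ) ≤ Real.sqrt 2 * δ * (2 * M - 4) :=
      mul_le_mul_of_nonneg_left hc2 hh.le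
    have e2 : Real.sqrt 2 * δ * (lamOrbit c x k 1 : ℝ) ≤ Real.sqrt 2 * δ * M :=
      mul_le_mul_of_nonneg_left hr2 hh.le
    rw [mem_rectQuad_carrier]
    simp only [Complex.re_ofReal_mul, Complex.im_ofReal_mul, TrackExchange.zsq_re,
      TrackExchange.zsq_im, Set.mem_Ioo]
    refine ⟨⟨mul_pos hδ (mul_pos hs0 (by linarith)), by linarith⟩,
      mul_pos hδ (mul_pos hs0 (by linarith)), by linarith⟩
  -- the orbit segment is an open path of the laminated configuration inside the box
  have hreachT : ∀ k, k ≤ k₀ → ∀ (h0 : (δ : ℂ) * squareLatticeEmbedding.z x ∈ (rectQuad 0 2 0 1 two_pos one_pos).carrier)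
      (hk : (δ : ℂ) * squareLatticeEmbedding.z (lamOrbit c x k) ∈ (rectQuad 0 2 0 1 two_pos one_pos).carrier),
      ((openGraph (lamConfig c)).induce
        {y : Site 2 | (δ : ℂ) * squareLatticeEmbedding.z y ∈ (rectQuad 0 2 0 1 two_pos one_pos).carrier}).Reachable
        ⟨x, h0⟩ ⟨lamOrbit c x k, hk⟩ := by
    intro k
    induction k with
    | zero => intro _ h0 hk; exact SimpleGraph.Reachable.refl _
    | succ k ih =>
      intro hk1 h0 hk
      refine (ih (by omega) h0 (hT k (by omega))).trans (SimpleGraph.Adj.reachable ?_)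
      rw [SimpleGraph.induce_adj]
      exact (adj_lamConfig_iff c _ _).2 (Or.inl rfl)
  rw [mem_embDomainCrossing_iff]
  refine ⟨x, ?_, lamOrbit c x k₀, ?_, hT 0 (Nat.zero_le _), hT k₀ le_rfl,
    hreachT k₀ le_rfl _ _⟩
  · -- the start `(1,1)` is within `√2 δ ≤ 2δ` of the bottom side
    set p : ℂ := (δ : ℂ) * squareLatticeEmbedding.z x with hp
    have hpre : p.re = Real.sqrt 2 * δ := by
      rw [hp, Complex.re_ofReal_mul, TrackExchange.zsq_re, hx0]; push_cast; ring
    have hpim : p.im = Real.sqrt 2 * δ := by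
      rw [hp, Complex.im_ofReal_mul, TrackExchange.zsq_im, hx1]; push_cast; ring
    have ha : (⟨p.re, 0⟩ : ℂ) ∈ (rectQuad 0 2 0 1 two_pos one_pos).arc 0 := by
      rw [mem_rectQuad_arc_zero]
      exact ⟨rfl, by rw [hpre]; exact hh.le, by rw [hpre]; linarith⟩
    calc Metric.infDist p ((rectQuad 0 2 0 1 two_pos one_pos).arc 0) ≤ dist p ⟨p.re, 0⟩ := Metric.infDist_le_dist_of_mem ha
      _ = dist p.im 0 := Complex.dist_of_re_eq rfl
      _ = Real.sqrt 2 * δ := by rw [hpim, Real.dist_eq, sub_zero, abs_of_pos hh]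
      _ ≤ 2 * δ := h22
  · -- the end (row `M`) is within `1 - √2 δ M ≤ √2 δ ≤ 2δ` of the top side
    set q : ℂ := (δ : ℂ) * squareLatticeEmbedding.z (lamOrbit c x k₀) with hq
    have hqim : q.im = Real.sqrt 2 * δ * M := by
      rw [hq, Complex.im_ofReal_mul, TrackExchange.zsq_im, hrow]; push_cast; ring
    have hqre : q.re ∈ Set.Ioo (0 : ℝ) 2 := ((mem_rectQuad_carrier _ _).1 (hT k₀ le_rfl)).1
    have hb : (⟨q.re, 1⟩ : ℂ) ∈ (rectQuad 0 2 0 1 two_pos one_pos).arc 2 := by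
      rw [mem_rectQuad_arc_two]
      exact ⟨rfl, hqre.1.le, hqre.2.le⟩
    calc Metric.infDist q ((rectQuad 0 2 0 1 two_pos one_pos).arc 2) ≤ dist q ⟨q.re, 1⟩ := Metric.infDist_le_dist_of_mem hb
      _ = dist q.im 1 := Complex.dist_of_re_eq rfl
      _ = 1 - Real.sqrt 2 * δ * M := by
          rw [hqim, Real.dist_eq, abs_of_nonpos (by linarith)]; ring
      _ ≤ 2 * δ := by linarith

/-! ### The orbit bound at ratio `3` and the laminated crossing bound -/

/-- **Orbit bound at ratio `3`.** With fair coins, the forward lamination orbit of `x` makes at most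
`m` north steps among its first `3m` steps with probability at most
`3^m (4/3)^(3m) (1/2)^(3m) = (8/9)^m`. -/
theorem real_orbitEvent_le_three (p : Site 2 × Fin 2 → unitInterval) (hp : ∀ v, p (v, 0) = half)
    (x : Site 2) (m : ℕ) :
    (prodBernoulli p).real {S | lamOrbit (coins S) x (3 * m) 1 ≤ x 1 + m} ≤ (8 / 9 : ℝ) ^ m := by
  classical
  set A := (Finset.univ : Finset (Finset (Fin (3 * m)))).filter (fun s => s.card ≤ m) with hA
  calc (prodBernoulli p).real {S | lamOrbit (coins S) x (3 * m) 1 ≤ x 1 + m}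
      ≤ (prodBernoulli p).real (⋃ s ∈ A, patCyl x s) :=
        measureReal_mono (orbitEvent_subset x (3 * m) m) (measure_ne_top _ _)
    _ ≤ ∑ s ∈ A, (prodBernoulli p).real (patCyl x s) := measureReal_biUnion_finset_le _ _
    _ = A.card * (1 / 2 : ℝ) ^ (3 * m) := by simp [real_patCyl p hp, Finset.sum_const]
    _ ≤ (3 ^ m * (4 / 3 : ℝ) ^ (3 * m)) * (1 / 2 : ℝ) ^ (3 * m) := by
        gcongr; exact card_filter_card_le (3 * m) m
    _ = (8 / 9 : ℝ) ^ m := by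
        rw [pow_mul, pow_mul, ← mul_pow, ← mul_pow]; norm_num

/-- **Laminated crossing bound.** At `s = 1`, for a mesh `δ > 0` whose topmost admissible row is
`M ≥ 3` (`√2 δ M < 1 ≤ √2 δ (M+1)`), the crude bottom-to-top crossing probability of
`(0,2) × (0,1)` is at least `1 - (8/9)^(M-2)`. -/
theorem laminated_crudeCrossing_ge {δ : ℝ} (hδ : 0 < δ) {M : ℕ} (hM : 3 ≤ M)
    (hM1 : Real.sqrt 2 * δ * M < 1) (hM2 : 1 ≤ Real.sqrt 2 * δ * (M + 1)) :
    1 - (8 / 9 : ℝ) ^ (M - 2) ≤ extCornerCrossingProb 1 (rectQuad 0 2 0 1 two_pos one_pos) δ := by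
  set E := embDomainCrossing squareLatticeEmbedding.z (rectQuad 0 2 0 1 two_pos one_pos).carrier δ ((rectQuad 0 2 0 1 two_pos one_pos).arc 0) ((rectQuad 0 2 0 1 two_pos one_pos).arc 2)
    with hE
  set μ := prodBernoulli (extCornerParam 1) with hμ
  set G : Set (Set (Site 2 × Fin 2)) := {S | ∀ v, (v, (1 : Fin 2)) ∈ S} with hG
  set B : Set (Set (Site 2 × Fin 2)) :=
    {S | lamOrbit (coins S) ![1, 1] (3 * (M - 2)) 1 ≤ (![1, 1] : Site 2) 1 + ((M - 2 : ℕ) : ℤ)}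
    with hB
  have hsub : G ∩ Bᶜ ⊆ {S | cornerConfig S ∈ E} := by
    rintro S ⟨hSG, hSB⟩
    show cornerConfig S ∈ E
    rw [cornerConfig_eq_lamConfig hSG]
    exact lam_crudeCrossing_of_orbit _ hδ hM hM1 hM2 hSB
  have hG0 : μ.real Gᶜ = 0 := by
    have h := ae_forall_splitting_mem
    rw [ae_iff] at h
    rw [measureReal_eq_zero_iff (measure_ne_top _ _)]
    exact h
  have hB : μ.real B ≤ (8 / 9 : ℝ) ^ (M - 2) :=
    real_orbitEvent_le_three _ (fun v => extCornerParam_apply_zero 1 v) _ _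
  have huniv : μ.real Set.univ = 1 := probReal_univ
  have h1 : μ.real Set.univ ≤ μ.real (G ∩ Bᶜ) + μ.real (Gᶜ ∪ B) := by
    have hcov : (Set.univ : Set (Set (Site 2 × Fin 2))) ⊆ (G ∩ Bᶜ) ∪ (Gᶜ ∪ B) := by
      intro S _
      by_cases hG' : S ∈ G <;> by_cases hB' : S ∈ B <;> simp [hG', hB']
    calc μ.real Set.univ ≤ μ.real ((G ∩ Bᶜ) ∪ (Gᶜ ∪ B)) :=
          measureReal_mono hcov (measure_ne_top _ _)
      _ ≤ μ.real (G ∩ Bᶜ) + μ.real (Gᶜ ∪ B) := measureReal_union_le _ _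
  have h2 : μ.real (Gᶜ ∪ B) ≤ μ.real Gᶜ + μ.real B := measureReal_union_le _ _
  have h3 : μ.real (G ∩ Bᶜ) ≤ μ.real {S | cornerConfig S ∈ E} :=
    measureReal_mono hsub (measure_ne_top _ _)
  show 1 - (8 / 9 : ℝ) ^ (M - 2) ≤ μ.real {S | cornerConfig S ∈ E}
  linarith

/-- **FKG is load-bearing for `WeakBoxCrossing`**: the extended statement is false (witness
`s = 1`: the crude easy-way crossing probability of `(0,2) × (0,1)` tends to `1` as `δ → 0⁺`, so no
`c > 0` bounds it away from `1` along any sequence of meshes). Any proof of `WeakBoxCrossing` must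
use an input that fails beyond `t = 1` — positive association of `M_t` — since translation
invariance, the diagonal symmetry, self-duality, exact-`1/2` squares and range-`1` dependence all
persist up to `s = 1`. -/
theorem weakBoxCrossing_false_without_FKG : ¬ WeakBoxCrossingWithoutFKG := by
  intro h
  obtain ⟨c, hc, hδ⟩ := h 1
  obtain ⟨m₀, hm₀⟩ := exists_pow_lt_of_lt_one hc (by norm_num : (8 / 9 : ℝ) < 1)
  have hs0 : (0 : ℝ) < Real.sqrt 2 := by positivity
  have hδ₀pos : (0 : ℝ) < 1 / (Real.sqrt 2 * (m₀ + 4)) := by positivity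
  obtain ⟨δ, hδpos, hδlt, hP⟩ := hδ _ hδ₀pos
  -- `y = 1/(√2 δ) > m₀ + 4`; the top row is `M = ⌈y⌉₊ - 1`
  set y : ℝ := 1 / (Real.sqrt 2 * δ) with hy
  have hypos : 0 < y := by positivity
  have hδy : Real.sqrt 2 * δ * y = 1 := by rw [hy]; field_simp
  have hy_gt : (m₀ + 4 : ℝ) < y := by
    have h1 : δ * (Real.sqrt 2 * (m₀ + 4)) < 1 := by
      rwa [lt_div_iff₀ (by positivity)] at hδlt
    rw [hy, lt_div_iff₀ (by positivity)]
    linarith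
  have hN1 : y ≤ ⌈y⌉₊ := Nat.le_ceil y
  have hN2 : (⌈y⌉₊ : ℝ) < y + 1 := Nat.ceil_lt_add_one hypos.le
  have hNgt : m₀ + 4 < ⌈y⌉₊ := by exact_mod_cast hy_gt.trans_le hN1
  have hM3 : 3 ≤ ⌈y⌉₊ - 1 := by omega
  have hMN : ((⌈y⌉₊ - 1 : ℕ) : ℝ) + 1 = ⌈y⌉₊ := by
    have : ⌈y⌉₊ - 1 + 1 = ⌈y⌉₊ := by omega
    exact_mod_cast this
  have hsd : 0 < Real.sqrt 2 * δ := by positivity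
  have hM1 : Real.sqrt 2 * δ * ((⌈y⌉₊ - 1 : ℕ) : ℝ) < 1 := by
    have hlt : ((⌈y⌉₊ - 1 : ℕ) : ℝ) < y := by linarith
    calc Real.sqrt 2 * δ * ((⌈y⌉₊ - 1 : ℕ) : ℝ) < Real.sqrt 2 * δ * y := by gcongr
      _ = 1 := hδy
  have hM2 : 1 ≤ Real.sqrt 2 * δ * (((⌈y⌉₊ - 1 : ℕ) : ℝ) + 1) := by
    rw [hMN]
    calc (1 : ℝ) = Real.sqrt 2 * δ * y := hδy.symm
      _ ≤ Real.sqrt 2 * δ * ⌈y⌉₊ := by gcongr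
  have hge := laminated_crudeCrossing_ge hδpos hM3 hM1 hM2
  have hpow : (8 / 9 : ℝ) ^ (⌈y⌉₊ - 1 - 2) ≤ (8 / 9) ^ m₀ :=
    pow_le_pow_of_le_one (by norm_num) (by norm_num) (by omega)
  linarith

end

end Summit.CriticalPhenomena.CardyFormulaZ2.Theorems.WeakBoxCrossing.Negative
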